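import Summits.CriticalPhenomena.PercolationContinuityZ3.Theorems.Transplant.FKConnectivityAllQForestAbsorptionDescent
import Summits.CriticalPhenomena.PercolationContinuityZ3.Theorems.Transplant.FKConnectivityAllQForestHubPairPendant
import Summits.CriticalPhenomena.PercolationContinuityZ3.Theorems.Transplant.FKConnectivityAllQForestPairSlide
import HarnessLib

/-!
# ABSORPTION MONOTONICITY ⇒ THE SQUARE-FREE ADJACENT FOREST RAYLEIGH NODE: the kernel arrow `HubPairAbsorptionMonoOn V → AdjForestRayleighNoSqOn V`

Support file (`--supports stmt-CriticalPhenomena-4575`), FK sub-lane `prim-bschramm-fk-1` (gen 26) of the post-continuity programme;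
builds on p205010 (kernel theorem, internal audit signed; external expert review pending).  No definitions, no named facts, no sorries;
standard axioms.  Part 2 of 2 of the assembly "M4" of memo bschramm/FROM-fk-1-g25-HUB-PAIR-DECOMPOSITION.md §6c/§6f (part 1:
`…ForestAbsorptionDescent`), on top of the landed pieces F1 (`adjForestNoSq_bad/good_split`, g25), F2 (`hubPair_counts_eq_pinned_of_adjacent`),
F3 (`hubPairOneClass_at_v`), F4d (`hubPair_counts_eq_two_mul_of_quotParallel`, `adjForestNoSq_counts_eq_two_mul_of_quotParallel`), F6
(`adjForestNoSq_bad_eq_good_of_parallel`), the class-form diamond (`adjForestNoSq_fibre_of_classDiamond`), the pendant-class reduction M2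
(`hubPairOneClass_of_pendantClass`), the last free pair (`exists_last_free_pair`), and the typed node AAM = `HubPairAbsorptionMonoOn` (g25, NOT
asserted; 0 failures on all graphs with ≤ 10 vertices — 657,794,022 tests at n = 10 — and ≈ 9·10⁶ sampled tests up to n = 14).

THE ARROW **`adjForestRayleighNoSqOn_of_absorptionMono : HubPairAbsorptionMonoOn V → AdjForestRayleighNoSqOn V`**.  Strong induction on the
number of free pairs; `[x]` = pinned class.  Degenerate positions (`e` or `f` not free, `[o] = [v]`, `[o] = [y]`, `[v] = [y]`) are equalities
or `bad = 0`.  If no free pair other than `e, f` leaves `[o]`, `ω ↦ ω ∖ f` injects bad into good (as in g25's (★) ⇒ node).  Otherwise take such a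
pair `p = z a` (`z ∈ [o]`): `[a] = [v]` or `[y]` is F6, `[a] = [o]` empties the fibre; (A) a second `[o]–[a]` pair halves (F4d, induction); (B) a
free pair from `[a]` to a FRESH class: decompose at `p` (F1) — the pinned term by induction, the one-class term (★) by one absorption and THE
DESCENT (part 1); (C) a quotient loop at `[a]` empties the fibre; (D) otherwise all further pairs at `[a]` go to `[v] ∪ [y]`: two to one class halve
and pin `a` to `v` or `y` (F4d + F3), one to each is the class-form diamond, exactly one is M2, none makes the one-class term vanish.
* `pairEvents_mem_menu`; **`adjForestRayleighNoSqOn_of_absorptionMono`**; **`adjForestRayleighNoSqPos_of_absorptionMonoPos`**.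
So the square-free adjacent forest Rayleigh node — adjacent-edge negative correlation of the arboreal gas / of uniform forest 2-colourings on
every finite graph — follows in the kernel from ONE monotonicity: pinning a free pair at the far vertex never increases the one-class hub-pair sum.
[cite: SempleWelsh2008, Conj. 1.1 (p. 2); Thm. 4.2 (p. 11)] [cite: CibulkaHladkyLaCroixWagner2008, Thm. 1 (p. 2)] [cite: Linusson2011, Prop. 2.6]
[cite: Grimmett2006, §1.5 (p. 13)]
-/

noncomputable section

namespace Summit.CriticalPhenomena.PercolationContinuityZ3.Theorems
namespace FK

open Set Literature.Probability.LatticeModels Literature.Probability.Percolation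
open scoped Classical symmDiff

variable {V : Type*} [Fintype V]

/-! ### The arrow -/

section Arrow

omit [Fintype V] in
/-- Membership of the four pair events in the menu of `…_of_quotParallel`. [folklore] -/
theorem pairEvents_mem_menu (e f : Sym2 V) :
    (univ : Set (BondConfig V)) ∈ ({univ, {ω | e ∈ ω}, {ω | f ∈ ω}, {ω | e ∈ ω ∧ f ∈ ω}} : Set (Set (BondConfig V))) ∧
      ({ω | e ∈ ω} : Set (BondConfig V)) ∈ ({univ, {ω | e ∈ ω}, {ω | f ∈ ω}, {ω | e ∈ ω ∧ f ∈ ω}} : Set (Set (BondConfig V))) ∧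
      ({ω | f ∈ ω} : Set (BondConfig V)) ∈ ({univ, {ω | e ∈ ω}, {ω | f ∈ ω}, {ω | e ∈ ω ∧ f ∈ ω}} : Set (Set (BondConfig V))) ∧
      ({ω | e ∈ ω ∧ f ∈ ω} : Set (BondConfig V)) ∈ ({univ, {ω | e ∈ ω}, {ω | f ∈ ω}, {ω | e ∈ ω ∧ f ∈ ω}} : Set (Set (BondConfig V))) :=
  ⟨mem_insert _ _, mem_insert_of_mem _ (mem_insert _ _), mem_insert_of_mem _ (mem_insert_of_mem _ (mem_insert _ _)),
    mem_insert_of_mem _ (mem_insert_of_mem _ (mem_insert_of_mem _ (mem_singleton _)))⟩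

/-- **ABSORPTION MONOTONICITY ⇒ THE SQUARE-FREE ADJACENT FOREST RAYLEIGH NODE.**  If the one-class hub-pair sum never increases when a
free pair at the far vertex is pinned (`HubPairAbsorptionMonoOn V`, g25's AAM), then `bad ≤ good` on every fibre of `V`.
[cite: SempleWelsh2008, Conj. 1.1 (p. 2); Thm. 4.2 (p. 11)] [cite: CibulkaHladkyLaCroixWagner2008, Thm. 1 (p. 2)] [cite: Linusson2011, Prop. 2.6] -/
theorem adjForestRayleighNoSqOn_of_absorptionMono (hA : HubPairAbsorptionMonoOn V) : AdjForestRayleighNoSqOn V := by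
  suffices H : ∀ (k : ℕ) (M u₀ : BondConfig V), M.ncard = k → Disjoint u₀ M → ∀ (o v y : V), v ≠ y →
      fibreCount M u₀ (forestEv V ∩ {ω | s(o, v) ∈ ω ∧ s(o, y) ∈ ω}) (forestEv V) ≤
        fibreCount M u₀ (forestEv V ∩ {ω | s(o, v) ∈ ω}) (forestEv V ∩ {ω | s(o, y) ∈ ω}) from
    fun M u₀ hd o v y hvy => H _ M u₀ rfl hd o v y hvy
  intro k
  induction k using Nat.strong_induction_on with
  | _ k ih =>
    intro M u₀ hk hd o v y hvy
    have IH : ∀ (M' u' : BondConfig V), M'.ncard < k → Disjoint u' M' → ∀ (o v y : V), v ≠ y →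
        fibreCount M' u' (forestEv V ∩ {ω | s(o, v) ∈ ω ∧ s(o, y) ∈ ω}) (forestEv V) ≤
          fibreCount M' u' (forestEv V ∩ {ω | s(o, v) ∈ ω}) (forestEv V ∩ {ω | s(o, y) ∈ ω}) :=
      fun M' u' hlt hd' => ih _ hlt M' u' rfl hd'
    have hef : s(o, v) ≠ s(o, y) := fun h' => hvy (Sym2.congr_right.1 h')
    have R := fun (z : V) => SimpleGraph.Reachable.refl (G := openGraph u₀) z
    by_cases heM : s(o, v) ∈ M
    swap
    · by_cases heu : s(o, v) ∈ u₀
      · exact (adjForestNoSq_bad_eq_good_of_pinned hd heu).le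
      · rw [adjForestNoSq_bad_eq_zero_of_notMem heM heu]; exact Nat.zero_le _
    by_cases hfM : s(o, y) ∈ M
    swap
    · by_cases hfu : s(o, y) ∈ u₀
      · exact (adjForestNoSq_bad_eq_good_of_pinned' hd hfu).le
      · rw [adjForestNoSq_bad_eq_zero_of_notMem' hfM hfu]; exact Nat.zero_le _
    by_cases hov : (openGraph u₀).Reachable o v
    · exact adjForestNoSq_le_of_pinned_ov hd hov
    by_cases hoy : (openGraph u₀).Reachable o y
    · exact adjForestNoSq_le_of_pinned_oy hd hoy
    by_cases hcl : (openGraph u₀).Reachable v y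
    · exact adjForestNoSq_le_of_pinned_vy hd hvy hcl
    have hov' : o ≠ v := fun h => hov (h ▸ R o)
    have hoy' : o ≠ y := fun h => hoy (h ▸ R o)
    by_cases hstar : ∃ p ∈ M, p ≠ s(o, v) ∧ p ≠ s(o, y) ∧ ¬ p.IsDiag ∧ ∃ z ∈ p, (openGraph u₀).Reachable o z
    swap
    · -- NO STAR PAIR: `ω ↦ ω ∖ {f}` injects bad into good (as in `adjForestRayleighNoSqOn_of_hubPairOneClass`)
      push Not at hstar
      have hfu : s(o, y) ∉ u₀ := fun h' => hd.le_bot ⟨h', hfM⟩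
      refine fibreCount_le_of_injOn (fun ω => ω \ {s(o, y)}) (fun ω hω hA' hB => ?_) (fun ω ω' hω hA' hB hω' hA'' hB' hφ => ?_)
      · obtain ⟨hF, he, hf⟩ := hA'
        obtain ⟨hsub, hsub'⟩ := pinned_subset_and_partner hd hω
        have hfB : s(o, y) ∉ ω ∆ M := fun h' => by
          rcases Set.mem_symmDiff.1 h' with h'' | h''
          · exact h''.2 hfM
          · exact h''.2 hf
        have hpartner : (ω \ {s(o, y)}) ∆ M = insert s(o, y) (ω ∆ M) := by
          ext q
          constructor
          · intro hq
            rcases Set.mem_symmDiff.1 hq with ⟨⟨hqω, -⟩, hqM⟩ | ⟨hqM, hqn⟩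
            · exact mem_insert_of_mem _ (Set.mem_symmDiff.2 (Or.inl ⟨hqω, hqM⟩))
            · by_cases hq' : q = s(o, y)
              · rw [hq']; exact mem_insert _ _
              · exact mem_insert_of_mem _ (Set.mem_symmDiff.2 (Or.inr ⟨hqM, fun hqω => hqn ⟨hqω, hq'⟩⟩))
          · rintro (rfl | hq)
            · exact Set.mem_symmDiff.2 (Or.inr ⟨hfM, fun h' => h'.2 rfl⟩)
            · rcases Set.mem_symmDiff.1 hq with ⟨hqω, hqM⟩ | ⟨hqM, hqω⟩
              · refine Set.mem_symmDiff.2 (Or.inl ⟨⟨hqω, fun hq' => hqM ?_⟩, hqM⟩)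
                rw [mem_singleton_iff.1 hq']; exact hfM
              · exact Set.mem_symmDiff.2 (Or.inr ⟨hqM, fun h' => hqω h'.1⟩)
        have hnot : ¬ (openGraph (ω ∆ M)).Reachable o y := by
          intro hreach
          have hclosed : ∀ q ∈ ω ∆ M, ¬ q.IsDiag → ∀ z ∈ q, (openGraph u₀).Reachable o z → q ∈ u₀ := by
            intro q hq hqd z hz hoz
            rcases Set.mem_symmDiff.1 hq with hq' | hq'
            · have : q ∈ ω \ M := hq'
              rw [hω] at this; exact this
            · exfalso
              have hqe : q ≠ s(o, v) := fun h' => hq'.2 (h' ▸ he)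
              have hqf : q ≠ s(o, y) := fun h' => hq'.2 (h' ▸ hf)
              exact hstar q hq'.1 hqe hqf hqd z hz hoz
          have hpin : (openGraph u₀).Reachable o y := reachable_pinned_of_closed hclosed hreach
          exact hoy hpin
        refine ⟨?_, ⟨⟨fun q hq => hF.1 q hq.1, hF.2.anti (openGraph_mono sdiff_subset)⟩, ⟨he, fun h' => hef h'⟩⟩, ?_⟩
        · rw [Set.sdiff_sdiff_comm, hω]; exact sdiff_singleton_eq_self hfu
        · rw [hpartner]
          exact ⟨(isForestCfg_insert_iff hoy' hfB).2 ⟨hB, hnot⟩, mem_insert _ _⟩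
      · have h1 : insert s(o, y) (ω \ {s(o, y)}) = ω := by rw [insert_sdiff_singleton, insert_eq_of_mem hA'.2.2]
        have h2 : insert s(o, y) (ω' \ {s(o, y)}) = ω' := by rw [insert_sdiff_singleton, insert_eq_of_mem hA''.2.2]
        rw [← h1, ← h2, hφ]
    -- A STAR PAIR `p = s(z, a)` of the quotient
    obtain ⟨p, hpM, hpe, hpf, hpd, z, hzp, hoz⟩ := hstar
    set a := Sym2.Mem.other hzp with hadef
    have hp : s(z, a) = p := Sym2.other_spec hzp
    have hza : z ≠ a := fun h' => hpd (by rw [← hp]; exact Sym2.mk_isDiag_iff.2 h')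
    rw [← hp] at hpM hpe hpf
    by_cases hva : (openGraph u₀).Reachable v a
    · exact (adjForestNoSq_bad_eq_good_of_parallel hd heM hpM hpe hpf hov' hza hvy hoz hva).le
    by_cases hya : (openGraph u₀).Reachable y a
    · have key := adjForestNoSq_bad_eq_good_of_parallel (v := y) (y := v) hd hfM hpM hpf hpe hoy' hza hvy.symm hoz hya
      have hEF : {ω : BondConfig V | s(o, y) ∈ ω ∧ s(o, v) ∈ ω} = {ω | s(o, v) ∈ ω ∧ s(o, y) ∈ ω} := by
        ext ω; simp only [mem_setOf_eq]; exact and_comm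
      rw [hEF, fibreCount_swap M u₀ (forestEv V ∩ {ω | s(o, y) ∈ ω})] at key
      exact key.le
    by_cases hoa : (openGraph u₀).Reachable o a
    · have h0 := fibreCount_forest_eq_zero_of_quotLoop hd hpM (hoz.symm.trans hoa) {ω | s(o, v) ∈ ω ∧ s(o, y) ∈ ω} univ
      rw [inter_univ] at h0
      rw [h0]; exact Nat.zero_le _
    have hao : ¬ (openGraph u₀).Reachable a o := fun h => hoa h.symm
    have hav : ¬ (openGraph u₀).Reachable a v := fun h => hva h.symm
    have hay : ¬ (openGraph u₀).Reachable a y := fun h => hya h.symm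
    obtain ⟨mU, mE, mF, mEF⟩ := pairEvents_mem_menu (V := V) s(o, v) s(o, y)
    have hkM : (M \ {s(z, a)}).ncard + 1 = k := by rw [← hk]; exact Set.ncard_sdiff_singleton_add_one hpM (Set.toFinite M)
    -- (A) a second `[o]–[a]` pair: double pairs halve
    by_cases hA2 : ∃ z' w', s(z', w') ∈ M ∧ s(z', w') ≠ s(z, a) ∧ (openGraph u₀).Reachable o z' ∧ (openGraph u₀).Reachable a w'
    · obtain ⟨z', w', hp'M, hne', hoz', haw'⟩ := hA2
      have hz'w' : z' ≠ w' := fun h => hoa (hoz'.trans (h ▸ haw'.symm))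
      have he2 : s(z', w') ≠ s(o, v) := by
        intro h'; rcases Sym2.eq_iff.1 h' with ⟨-, h2⟩ | ⟨h1, -⟩
        · exact hav (haw'.trans (h2 ▸ R v))
        · exact hov ((hoz'.trans (h1 ▸ R v)))
      have hf2 : s(z', w') ≠ s(o, y) := by
        intro h'; rcases Sym2.eq_iff.1 h' with ⟨-, h2⟩ | ⟨h1, -⟩
        · exact hay (haw'.trans (h2 ▸ R y))
        · exact hoy ((hoz'.trans (h1 ▸ R y)))
      have hb2 := adjForestNoSq_counts_eq_two_mul_of_quotParallel (o := o) (v := v) (y := y) hd hpM hp'M hne' (hoz.symm.trans hoz') haw'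
        hza hz'w' hpe he2 hpf hf2 _ _ mEF mU
      have hg2 := adjForestNoSq_counts_eq_two_mul_of_quotParallel (o := o) (v := v) (y := y) hd hpM hp'M hne' (hoz.symm.trans hoz') haw'
        hza hz'w' hpe he2 hpf hf2 _ _ mE mF
      simp only [inter_univ] at hb2
      have hsub2 : M \ {s(z, a), s(z', w')} ⊆ M \ {s(z, a)} := sdiff_subset_sdiff_right (singleton_subset_iff.2 (mem_insert _ _))
      have hlt : (M \ {s(z, a), s(z', w')}).ncard < k := by
        have := Set.ncard_le_ncard hsub2 (Set.toFinite _); omega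
      have hd2 : Disjoint (insert s(z, a) u₀) (M \ {s(z, a), s(z', w')}) :=
        Set.disjoint_insert_left.2 ⟨fun h => h.2 (mem_insert _ _), hd.mono_right sdiff_subset⟩
      have key := IH _ _ hlt hd2 o v y hvy
      rw [hb2, hg2]; omega
    -- the decomposition at `p` (F1): the node follows from (★) at `(o, a)` on `(M ∖ p, u₀)`
    have hdN : Disjoint u₀ (M \ {s(z, a)}) := hd.mono_right sdiff_subset
    have hpN : s(z, a) ∉ M \ {s(z, a)} := fun h' => h'.2 rfl
    have hpu : s(z, a) ∉ u₀ := fun h' => hd.le_bot ⟨h', hpM⟩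
    have hMN : M = insert s(z, a) (M \ {s(z, a)}) := by rw [insert_sdiff_singleton, insert_eq_of_mem hpM]
    have decomp :
        fibreCount (M \ {s(z, a)}) u₀ (forestEv V ∩ {ω | s(o, v) ∈ ω ∧ s(o, y) ∈ ω} ∩ reachEv o a) (forestEv V ∩ (reachEv o a)ᶜ) +
            fibreCount (M \ {s(z, a)}) u₀ (forestEv V ∩ reachEv o a) (forestEv V ∩ {ω | s(o, v) ∈ ω ∧ s(o, y) ∈ ω} ∩ (reachEv o a)ᶜ) ≤
          fibreCount (M \ {s(z, a)}) u₀ (forestEv V ∩ {ω | s(o, v) ∈ ω} ∩ reachEv o a) (forestEv V ∩ {ω | s(o, y) ∈ ω} ∩ (reachEv o a)ᶜ) +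
            fibreCount (M \ {s(z, a)}) u₀ (forestEv V ∩ {ω | s(o, y) ∈ ω} ∩ reachEv o a) (forestEv V ∩ {ω | s(o, v) ∈ ω} ∩ (reachEv o a)ᶜ) →
        fibreCount M u₀ (forestEv V ∩ {ω | s(o, v) ∈ ω ∧ s(o, y) ∈ ω}) (forestEv V) ≤
          fibreCount M u₀ (forestEv V ∩ {ω | s(o, v) ∈ ω}) (forestEv V ∩ {ω | s(o, y) ∈ ω}) := by
      intro hS
      have hbad := adjForestNoSq_bad_split (u := u₀) (e := s(o, v)) (f := s(o, y)) hza hpN hpu hpe hpf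
      have hgood := adjForestNoSq_good_split (u := u₀) (e := s(o, v)) (f := s(o, y)) hza hpN hpu hpe hpf
      have hlt : (M \ {s(z, a)}).ncard < k := by omega
      have hih := IH _ _ hlt (Set.disjoint_insert_left.2 ⟨hpN, hdN⟩) o v y hvy
      have c1 := fibreCount_reach_congr_of_pinned hdN hoz (forestEv V ∩ {ω | s(o, v) ∈ ω ∧ s(o, y) ∈ ω}) (forestEv V) (w := a)
      have c2 := fibreCount_reach_congr_of_pinned hdN hoz (forestEv V) (forestEv V ∩ {ω | s(o, v) ∈ ω ∧ s(o, y) ∈ ω}) (w := a)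
      have c3 := fibreCount_reach_congr_of_pinned hdN hoz (forestEv V ∩ {ω | s(o, v) ∈ ω}) (forestEv V ∩ {ω | s(o, y) ∈ ω}) (w := a)
      have c4 := fibreCount_reach_congr_of_pinned hdN hoz (forestEv V ∩ {ω | s(o, y) ∈ ω}) (forestEv V ∩ {ω | s(o, v) ∈ ω}) (w := a)
      rw [hMN, hbad, hgood, c1, c2, c3, c4]
      omega
    -- (B) a free pair from `[a]` to a fresh class: one absorption and the descent
    by_cases hB : ∃ a₁ x, s(a₁, x) ∈ M ∧ (openGraph u₀).Reachable a a₁ ∧ ¬ (openGraph u₀).Reachable a x ∧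
        ¬ (openGraph u₀).Reachable o x ∧ ¬ (openGraph u₀).Reachable v x ∧ ¬ (openGraph u₀).Reachable y x
    · obtain ⟨a₁, x, hqM, ha₁, hax, hox, hvx, hyx⟩ := hB
      have hqp : s(a₁, x) ≠ s(z, a) := by
        intro h'; rcases Sym2.eq_iff.1 h' with ⟨h1, -⟩ | ⟨-, h2⟩
        · exact hao (ha₁.trans (h1 ▸ hoz.symm))
        · exact hox (h2 ▸ hoz)
      have hqN : s(a₁, x) ∈ M \ {s(z, a)} := ⟨hqM, fun h => hqp (mem_singleton_iff.1 h)⟩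
      have hxo : x ≠ o := fun h => hox (h ▸ R x)
      have hxv : x ≠ v := fun h => hvx (h ▸ R x)
      have hxy : x ≠ y := fun h => hyx (h ▸ R x)
      have hqe : s(a₁, x) ≠ s(o, v) := by
        intro h'; rcases Sym2.eq_iff.1 h' with ⟨h1, -⟩ | ⟨h1, -⟩
        · exact hao (h1 ▸ ha₁)
        · exact hav (h1 ▸ ha₁)
      have hqf : s(a₁, x) ≠ s(o, y) := by
        intro h'; rcases Sym2.eq_iff.1 h' with ⟨h1, -⟩ | ⟨h1, -⟩
        · exact hao (h1 ▸ ha₁)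
        · exact hay (h1 ▸ ha₁)
      have hk2 : ((M \ {s(z, a)}) \ {s(a₁, x)}).ncard + 1 = (M \ {s(z, a)}).ncard :=
        Set.ncard_sdiff_singleton_add_one hqN (Set.toFinite _)
      have hd' : Disjoint (insert s(a₁, x) u₀) ((M \ {s(z, a)}) \ {s(a₁, x)}) :=
        Set.disjoint_insert_left.2 ⟨fun h => h.2 rfl, hdN.mono_right sdiff_subset⟩
      have far : ∀ s : V, ¬ (openGraph u₀).Reachable s a₁ → ¬ (openGraph u₀).Reachable s x → ∀ t, ¬ (openGraph u₀).Reachable s t →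
          ¬ (openGraph (insert s(a₁, x) u₀)).Reachable s t := fun s h1 h2 t h3 h =>
        h3 (reachable_of_reachable_insert_pinned h h1 h2)
      have hoa₁ : ¬ (openGraph u₀).Reachable o a₁ := fun h => hao (ha₁.trans h.symm)
      have hva₁ : ¬ (openGraph u₀).Reachable v a₁ := fun h => hav (ha₁.trans h.symm)
      have hya₁ : ¬ (openGraph u₀).Reachable y a₁ := fun h => hay (ha₁.trans h.symm)
      have hrec := hubPairOneClass_descent hA IH _ ((M \ {s(z, a)}) \ {s(a₁, x)}) (insert s(a₁, x) u₀) rfl (by omega) hd' o v y a₁ hvy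
        ⟨⟨heM, fun h => hpe (mem_singleton_iff.1 h).symm⟩, fun h => hqe (mem_singleton_iff.1 h).symm⟩
        ⟨⟨hfM, fun h => hpf (mem_singleton_iff.1 h).symm⟩, fun h => hqf (mem_singleton_iff.1 h).symm⟩
        (fun h => far o hoa₁ hox a₁ hoa₁ h.symm) (fun h => far v hva₁ hvx a₁ hva₁ h.symm) (fun h => far y hya₁ hyx a₁ hya₁ h.symm)
        (far o hoa₁ hox v hov) (far o hoa₁ hox y hoy)
      have step := hubPairOneClass_of_absorption_step hA hdN hvy hqN ha₁ hxo hxv hxy hqe hqf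
        (by simp only [setOf_reachable_eq_reachEv, setOf_not_reachable_eq_compl]; exact hrec)
      simp only [setOf_reachable_eq_reachEv, setOf_not_reachable_eq_compl] at step
      exact decomp step
    -- (C) a quotient loop at `[a]`: empty fibre
    by_cases hC : ∃ a₂ a₃, s(a₂, a₃) ∈ M ∧ (openGraph u₀).Reachable a a₂ ∧ (openGraph u₀).Reachable a a₃
    · obtain ⟨a₂, a₃, hlM, ha₂, ha₃⟩ := hC
      have h0 := fibreCount_forest_eq_zero_of_quotLoop hd hlM (ha₂.symm.trans ha₃) {ω | s(o, v) ∈ ω ∧ s(o, y) ∈ ω} univ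
      rw [inter_univ] at h0
      rw [h0]; exact Nat.zero_le _
    -- (D) every other free pair at `[a]` goes to `[v] ∪ [y]`
    have hvy_of : ∀ x₁ x₂ : V, s(x₁, x₂) ∈ M → s(x₁, x₂) ≠ s(z, a) → (openGraph u₀).Reachable a x₁ →
        (openGraph u₀).Reachable v x₂ ∨ (openGraph u₀).Reachable y x₂ := by
      intro x₁ x₂ hq hqp hx₁
      by_contra hn
      push Not at hn
      have hox₂ : ¬ (openGraph u₀).Reachable o x₂ := fun h =>
        hA2 ⟨x₂, x₁, Sym2.eq_swap ▸ hq, fun h' => hqp (Sym2.eq_swap.trans h'), h, hx₁⟩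
      have hax₂ : ¬ (openGraph u₀).Reachable a x₂ := fun h => hC ⟨x₁, x₂, hq, hx₁, h⟩
      exact hB ⟨x₁, x₂, hq, hx₁, hax₂, hox₂, hn.1, hn.2⟩
    have mem_of : ∀ x₁ x₂ : V, s(x₁, x₂) ∈ M → (openGraph u₀).Reachable a x₁ →
        ((openGraph u₀).Reachable v x₂ ∨ (openGraph u₀).Reachable y x₂) → s(x₁, x₂) ∈ M \ {s(z, a)} := by
      intro x₁ x₂ hq hx₁ hx₂
      refine ⟨hq, fun h' => ?_⟩
      rcases Sym2.eq_iff.1 (mem_singleton_iff.1 h') with ⟨h1, -⟩ | ⟨-, h2⟩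
      · exact hao (hx₁.trans (h1 ▸ hoz.symm))
      · rcases hx₂ with h | h
        · exact hov (hoz.trans (h2 ▸ h.symm))
        · exact hoy (hoz.trans (h2 ▸ h.symm))
    -- (D2) two pairs from `[a]` to `[v]` (or to `[y]`): F4d and F3
    by_cases hD2 : ∃ b₁ t₁ b₂ t₂, s(b₁, t₁) ∈ M ∧ s(b₂, t₂) ∈ M ∧ s(b₂, t₂) ≠ s(b₁, t₁) ∧ (openGraph u₀).Reachable a b₁ ∧
        (openGraph u₀).Reachable a b₂ ∧ (((openGraph u₀).Reachable v t₁ ∧ (openGraph u₀).Reachable v t₂) ∨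
          ((openGraph u₀).Reachable y t₁ ∧ (openGraph u₀).Reachable y t₂))
    · obtain ⟨b₁, t₁, b₂, t₂, hg₁M, hg₂M, hne12, hb₁, hb₂, ht⟩ := hD2
      have ht₁ : (openGraph u₀).Reachable v t₁ ∨ (openGraph u₀).Reachable y t₁ := ht.elim (fun h => Or.inl h.1) fun h => Or.inr h.1
      have ht₂ : (openGraph u₀).Reachable v t₂ ∨ (openGraph u₀).Reachable y t₂ := ht.elim (fun h => Or.inl h.2) fun h => Or.inr h.2
      have hg₁ := mem_of b₁ t₁ hg₁M hb₁ ht₁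
      have hg₂ := mem_of b₂ t₂ hg₂M hb₂ ht₂
      have htt : (openGraph u₀).Reachable t₁ t₂ := by
        rcases ht with ⟨h1, h2⟩ | ⟨h1, h2⟩
        · exact h1.symm.trans h2
        · exact h1.symm.trans h2
      have hbt : ∀ {b t : V}, (openGraph u₀).Reachable a b → ((openGraph u₀).Reachable v t ∨ (openGraph u₀).Reachable y t) → b ≠ t := by
        intro b t hb ht' h; subst h
        rcases ht' with h' | h'
        · exact hav (hb.trans h'.symm)
        · exact hay (hb.trans h'.symm)
      have hne_e : ∀ {b t : V}, (openGraph u₀).Reachable a b → s(b, t) ≠ s(o, v) := by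
        intro b t hb h'; rcases Sym2.eq_iff.1 h' with ⟨h1, -⟩ | ⟨h1, -⟩
        · exact hao (h1 ▸ hb)
        · exact hav (h1 ▸ hb)
      have hne_f : ∀ {b t : V}, (openGraph u₀).Reachable a b → s(b, t) ≠ s(o, y) := by
        intro b t hb h'; rcases Sym2.eq_iff.1 h' with ⟨h1, -⟩ | ⟨h1, -⟩
        · exact hao (h1 ▸ hb)
        · exact hay (h1 ▸ hb)
      refine decomp ?_
      have F := fun (P₀ Q₀ : Set (BondConfig V)) hP₀ hQ₀ =>
        hubPair_counts_eq_two_mul_of_quotParallel (u₀ := u₀) (M := M \ {s(z, a)}) (o := o) (v := v) (y := y) (a := a) hdN hg₁ hg₂ hne12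
          (hb₁.symm.trans hb₂) htt (hbt hb₁ ht₁) (hbt hb₂ ht₂) (hne_e hb₁) (hne_e hb₂) (hne_f hb₁) (hne_f hb₂) P₀ Q₀ hP₀ hQ₀
      have f1 := F _ _ mEF mU
      have f2 := F _ _ mU mEF
      have f3 := F _ _ mE mF
      have f4 := F _ _ mF mE
      simp only [inter_univ, setOf_reachable_eq_reachEv, setOf_not_reachable_eq_compl] at f1 f2 f3 f4
      rw [f1, f2, f3, f4]
      -- in the doubly pinned fibre `a` is pinned to `v` (or to `y`): (★) holds there (F3)
      have hd'' : Disjoint (insert s(b₁, t₁) u₀) ((M \ {s(z, a)}) \ {s(b₁, t₁), s(b₂, t₂)}) :=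
        Set.disjoint_insert_left.2 ⟨fun h => h.2 (mem_insert _ _), hdN.mono_right sdiff_subset⟩
      have hab₁' : (openGraph (insert s(b₁, t₁) u₀)).Reachable a t₁ :=
        (hb₁.mono (openGraph_mono (subset_insert _ _))).trans ((openGraph_adj _ b₁ t₁).2 ⟨mem_insert _ _, hbt hb₁ ht₁⟩).reachable
      rcases ht with ⟨hvt₁, -⟩ | ⟨hyt₁, -⟩
      · have key := hubPairOneClass_le_of_pinned_to_v (o := o) hd'' hvy (hab₁'.trans (hvt₁.mono (openGraph_mono (subset_insert _ _))).symm)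
        omega
      · have key := hubPairOneClass_symm (hubPairOneClass_le_of_pinned_to_v (o := o) (v := y) (y := v) hd'' hvy.symm
          (hab₁'.trans (hyt₁.mono (openGraph_mono (subset_insert _ _))).symm))
        omega
    -- (D11) one pair to `[v]` and one to `[y]`: the class-form diamond
    by_cases hD11 : ∃ b₁ v₁ b₂ y₂, s(b₁, v₁) ∈ M ∧ s(b₂, y₂) ∈ M ∧ (openGraph u₀).Reachable a b₁ ∧ (openGraph u₀).Reachable v v₁ ∧
        (openGraph u₀).Reachable a b₂ ∧ (openGraph u₀).Reachable y y₂
    · obtain ⟨b₁, v₁, b₂, y₂, hg₁M, hg₂M, hb₁, hv₁, hb₂, hy₂⟩ := hD11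
      exact adjForestNoSq_fibre_of_classDiamond hd hvy heM hfM hao hav hay hpM hoz (R a) (Sym2.eq_swap ▸ hg₁M) hv₁ hb₁ hg₂M hb₂ hy₂
    -- (D1) exactly one pair, to `[v]` or to `[y]`: the pendant-class reduction M2
    by_cases hD1v : ∃ b₁ v₁, s(b₁, v₁) ∈ M ∧ (openGraph u₀).Reachable a b₁ ∧ (openGraph u₀).Reachable v v₁
    · obtain ⟨b₁, v₁, hgM, hb₁, hv₁⟩ := hD1v
      have hg := mem_of b₁ v₁ hgM hb₁ (Or.inl hv₁)
      have honly : ∀ q ∈ M \ {s(z, a)}, ∀ w ∈ q, (openGraph u₀).Reachable a w → q = s(b₁, v₁) := by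
        intro q hq w hw haw
        set t := Sym2.Mem.other hw with htdef
        have hqwt : s(w, t) = q := Sym2.other_spec hw
        rw [← hqwt] at hq ⊢
        rcases hvy_of w t hq.1 (fun h => hq.2 (mem_singleton_iff.2 h)) haw with hvt | hyt
        · by_contra hne
          exact hD2 ⟨b₁, v₁, w, t, hgM, hq.1, hne, hb₁, haw, Or.inl ⟨hv₁, hvt⟩⟩
        · exact absurd ⟨b₁, v₁, w, t, hgM, hq.1, hb₁, hv₁, haw, hyt⟩ hD11
      have hk3 : ((M \ {s(z, a)}) \ {s(b₁, v₁)}).ncard + 1 = (M \ {s(z, a)}).ncard :=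
        Set.ncard_sdiff_singleton_add_one hg (Set.toFinite _)
      exact decomp (hubPairOneClass_of_pendantClass hdN hov' hvy ⟨heM, fun h => hpe (mem_singleton_iff.1 h).symm⟩ hg hb₁ hv₁ hav hao hay
        honly (IH _ _ (by omega) (hdN.mono_right sdiff_subset) o v y hvy))
    by_cases hD1y : ∃ b₂ y₂, s(b₂, y₂) ∈ M ∧ (openGraph u₀).Reachable a b₂ ∧ (openGraph u₀).Reachable y y₂
    · obtain ⟨b₂, y₂, hgM, hb₂, hy₂⟩ := hD1y
      have hg := mem_of b₂ y₂ hgM hb₂ (Or.inr hy₂)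
      have honly : ∀ q ∈ M \ {s(z, a)}, ∀ w ∈ q, (openGraph u₀).Reachable a w → q = s(b₂, y₂) := by
        intro q hq w hw haw
        set t := Sym2.Mem.other hw with htdef
        have hqwt : s(w, t) = q := Sym2.other_spec hw
        rw [← hqwt] at hq ⊢
        rcases hvy_of w t hq.1 (fun h => hq.2 (mem_singleton_iff.2 h)) haw with hvt | hyt
        · exact absurd ⟨w, t, hq.1, haw, hvt⟩ hD1v
        · by_contra hne
          exact hD2 ⟨b₂, y₂, w, t, hgM, hq.1, hne, hb₂, haw, Or.inr ⟨hy₂, hyt⟩⟩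
      have hk3 : ((M \ {s(z, a)}) \ {s(b₂, y₂)}).ncard + 1 = (M \ {s(z, a)}).ncard :=
        Set.ncard_sdiff_singleton_add_one hg (Set.toFinite _)
      exact decomp (hubPairOneClass_symm (hubPairOneClass_of_pendantClass (v := y) (y := v) hdN hoy' hvy.symm
        ⟨hfM, fun h => hpf (mem_singleton_iff.1 h).symm⟩ hg hb₂ hy₂ hay hao hav honly
        (IH _ _ (by omega) (hdN.mono_right sdiff_subset) o y v hvy.symm)))
    -- (D0) no other pair at `[a]`: the one-class term vanishes
    have hnone : ∀ q ∈ M \ {s(z, a)}, ∀ w ∈ q, ¬ (openGraph u₀).Reachable a w := by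
      intro q hq w hw haw
      set t := Sym2.Mem.other hw with htdef
      have hqwt : s(w, t) = q := Sym2.other_spec hw
      rw [← hqwt] at hq
      rcases hvy_of w t hq.1 (fun h => hq.2 (mem_singleton_iff.2 h)) haw with hvt | hyt
      · exact hD1v ⟨w, t, hq.1, haw, hvt⟩
      · exact hD1y ⟨w, t, hq.1, haw, hyt⟩
    refine decomp ?_
    have e1 : forestEv V ∩ (reachEv o a)ᶜ = forestEv V ∩ univ ∩ (reachEv o a)ᶜ := by rw [inter_univ]
    have e2 : forestEv V ∩ reachEv o a = forestEv V ∩ univ ∩ reachEv o a := by rw [inter_univ]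
    rw [e1, e2, typeA_count_eq_zero_of_no_pair hdN hnone, typeA_count_eq_zero_of_no_pair hdN hnone]
    exact Nat.zero_le _

/-- **`HubPairAbsorptionMonoPos → AdjForestRayleighNoSqPos`** (hence adjacent-edge negative correlation of the arboreal gas on every finite
graph, `ag_adjacent_negCorr_of_adjForestNoSq`). [cite: SempleWelsh2008, Conj. 1.1 (p. 2)] [cite: Grimmett2006, §1.5 (p. 13)] -/
theorem adjForestRayleighNoSqPos_of_absorptionMonoPos (h : HubPairAbsorptionMonoPos) : AdjForestRayleighNoSqPos :=
  fun n => adjForestRayleighNoSqOn_of_absorptionMono (h n)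

end Arrow


end FK
end Summit.CriticalPhenomena.PercolationContinuityZ3.Theorems

end
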